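import Summits.BirchSwinnertonDyer.BirchSwinnertonDyer.Theorems.KolyvaginDepthDoorDepthTableKuriharaDecisivePair
import HarnessLib

/-!
# Route `KolyvaginDepthDoor`, crux `KolyvaginDepthSupplyKN` (stmt-BirchSwinnertonDyer-22820) —
# DEPTH TABLE v22, CONSISTENCY: the depth-`r` named fact (v22) CONTAINS the depth-one fact (v19)

Helper file of the lead prover of line `levelone` (kdd-p1 g26; `--supports stmt-BirchSwinnertonDyer-22820 --as helper`);
it closes nothing and BSD is NOT proved by it.

The rows of the depth table carry two Sakamoto-2022 inputs about PRESCRIBED levels BY NAME: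
`Sakamoto2022_kuriharaNumber_prime_ne_zero_of_localNondivisible` (v19, depth one: `#Sel_p ≤ p` and ONE rational point
not `p`-divisible in `E(ℚ_ℓ)` ⟹ unit `δ̃_ℓ`) and `Sakamoto2022_kuriharaNumber_ne_zero_of_localizationInjective` (v22, depth `r`).
This file proves, in the tree, that the second IMPLIES the first (`r = 1`, `n = ℓ`, `P = ![P]`; a combination `a • P` with
`p ∤ a` is `p`-indivisible as soon as `P` is, by a modular inverse of `a`) — so a row may take `hSakR` alone, and the print
surface of v22 is not larger than that of v19. Pure logic over the two statements; nothing is asserted about either.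

References: [Sakamoto2022pSelmer] Lemma 4.4, Remark 4.5, Lemma 4.6 (1).
-/

set_option linter.dupNamespace false

noncomputable section

open scoped Classical NumberField

namespace Summit.BirchSwinnertonDyer.BirchSwinnertonDyer.Theorems.KolyvaginDepthDoor

open Literature.NumberTheory.EllipticCurves Literature.NumberTheory.EllipticCurves.ModularForms
  WeierstrassCurve NumberField IsDedekindDomain

/-- **The depth-`r` fact implies the depth-one fact** (`Sakamoto2022_kuriharaNumber_ne_zero_of_localizationInjective` at
`r = 1`, `n = ℓ`, `P = ![P]` gives `Sakamoto2022_kuriharaNumber_prime_ne_zero_of_localNondivisible`): if `P ∉ p·E(ℚ_ℓ)` then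
`a • P ∉ p·E(ℚ_ℓ)` for every `a` with `p ∤ a` (`localNondivisible_transport` with a modular inverse of `a`). CONDITIONAL on
nothing (an implication between two named statements); BSD is not proved by it.
[cite: Sakamoto2022pSelmer, Lemma 4.4, Remark 4.5, Lemma 4.6 (1) (arXiv:2106.03370 p. 14)] -/
theorem kuriharaNumber_prime_ne_zero_of_localNondivisible_of_localizationInjective
    (hSakR : Sakamoto2022_kuriharaNumber_ne_zero_of_localizationInjective) :
    Sakamoto2022_kuriharaNumber_prime_ne_zero_of_localNondivisible := by
  intro W _ _ p hp h5 hord hsur hnap htam N _ D hc hu hle ℓ hℓ hlev P hP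
  have hpP : p.Prime := hp.out
  haveI : NeZero ℓ := ⟨hℓ.out.ne_zero⟩
  have hcard : ℓ.primeFactors.card = 1 := by rw [hℓ.out.primeFactors, Finset.card_singleton]
  refine hSakR W p h5 hord hsur hnap htam D hc hu 1 (by rw [pow_one]; exact hle) ℓ hlev hcard ![P] ?_
  intro a ha
  obtain ⟨i, hi⟩ := ha
  have hi0 : ¬ p ∣ a 0 := by fin_cases i; exact hi
  -- a modular inverse of `a 0`: `u * a 0 = 1 + p * v`
  obtain ⟨u, v, huv⟩ : ∃ u v : ℕ, u * a 0 = 1 + p * v := by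
    have hc0 : (a 0 : ZMod p) ≠ 0 := by rwa [Ne, ZMod.natCast_eq_zero_iff]
    refine ⟨((a 0 : ZMod p)⁻¹).val, ((a 0 : ZMod p)⁻¹).val * a 0 / p, ?_⟩
    have h1 : ((((a 0 : ZMod p)⁻¹).val * a 0 : ℕ) : ZMod p) = ((1 : ℕ) : ZMod p) := by
      rw [Nat.cast_mul, ZMod.natCast_zmod_val, inv_mul_cancel₀ hc0, Nat.cast_one]
    have h2 := (ZMod.natCast_eq_natCast_iff' _ _ _).mp h1
    rw [Nat.mod_eq_of_lt hpP.one_lt] at h2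
    have h3 := Nat.div_add_mod (((a 0 : ZMod p)⁻¹).val * a 0) p
    omega
  refine ⟨ℓ, hℓ, by rw [hℓ.out.primeFactors]; exact Finset.mem_singleton_self _, fun Q hQ ↦ ?_⟩
  have hsum : (∑ j, a j • WeierstrassCurve.Affine.Point.map (W' := W.toAffine) (S := ℚ) (Algebra.ofId ℚ ℚ_[ℓ])
      ((![P] : Fin 1 → W.toAffine.Point) j)) =
      a 0 • WeierstrassCurve.Affine.Point.map (W' := W.toAffine) (S := ℚ) (Algebra.ofId ℚ ℚ_[ℓ]) P +
        0 • WeierstrassCurve.Affine.Point.map (W' := W.toAffine) (S := ℚ) (Algebra.ofId ℚ ℚ_[ℓ]) P := by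
    rw [Fin.sum_univ_one, zero_nsmul, add_zero]
    rfl
  rw [hsum] at hQ
  refine localNondivisible_transport p _ _ (a 0) 0 1 0 u v 0 huv (by ring) ?_ Q hQ
  simpa only [one_nsmul, zero_nsmul, add_zero] using hP

end Summit.BirchSwinnertonDyer.BirchSwinnertonDyer.Theorems.KolyvaginDepthDoor

end
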